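import Literature.Probability.Percolation.ConditionalPositiveAssociationProofs
import HarnessLib

/-!
# `NoHeavyLowerTail` (stmt-CriticalPhenomena-4575) — the POCKET-AUGMENTED van den Berg–Häggström–Kahn
# inequality, I: the pocket lemma and the base case

Support file (`--supports stmt-CriticalPhenomena-4575`, hull-port prover `prim-hp-2`, gen 21).  No named facts, no
sorries; standard axioms.  Finite-sum framework of `Literature/…/ConditionalPositiveAssociationProofs.lean`
(`BHK2006.weight`, `rC U s` = the open edge cluster of `s` in `G[U]`, `rD U s X = {s ↮ X in G[U]}`).

BHK (2006, Thm. 1.1; tree: `BHK2006.core`) prove, for increasing events `A, B` determined by the open edge cluster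
`C_s` and `R_X = {s ↮ X}`:  `P(A R_X) P(B R_Y) ≤ P(A B R_{X∩Y}) P(R_{X∪Y})`.  This series of three files replaces `B`
by the NON-monotone "pocket-augmented" event of a second vertex `o`,
    `F = {o ↔ s} ∪ {C(o) ∈ 𝒬}`     (`C(o)` = the vertex set of the open cluster of `o`, `𝒬` ANY family of
vertex sets disjoint from `Y`), the kernel of the B-side inequalities (Conjecture B3, prim-hp-2 MEMO-gen12 §6) behind
universal Kozma–Nitzan goodness at `|A| = 3` (MEMO-gen21).  This file: definitions and the new BASE CASE.

* `KNGoodPocketBHK.oV U o ω` (vertex cluster of `o` in `G[U]`), `fEv U s o 𝒬` (the event `F`), `pocketEv`, `meetS`,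
  `qRestr 𝒬 T = {W ∈ 𝒬 : W ∩ T = ∅}`.
* locality: `oV_eq_iff_inter_meetS` (`{C(o) = W}` is determined by the pairs meeting `W`), `rC_eq_diff_meetS`,
  `mem_rD_iff_diff_meetS` (on `{C(o) = W}`, `W ∌ s`, the cluster of `s` does not see the pairs meeting `W`).
* THE POCKET LEMMA `pocket_le` / `pocket_ge`: for `W ∌ s` and `H` increasing,
  `E[H(C_s); C(o)=W] ≤ P(C(o)=W)·E[H(C_s)]` and `P(C(o)=W)·P(s↮Y) ≤ P(C(o)=W, s↮Y)` (given `C(o) = W` the rest is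
  percolation on `G ∖ W`: block Fubini + monotonicity); summed over the pockets outside `F` (`one_sub_ind_fEv`):
  `sum_mul_fEv_ge` (`E[H]·P(F) ≤ E[H 1_F]`) and `sum_fEv_rD_le` (`P(F, s↮Y) ≤ P(F)·P(s↮Y)`).
* `KNGoodPocketBHK.base` — **`E[H(C_s) 1{s↮X}] · P(F, s↮Y) ≤ E[H(C_s) 1_F] · P(s↮X, s↮Y)`** (the two pocket
  inequalities and two applications of Harris), the base case `X ∩ Y = ∅` of the induction in `…KNGoodPocketBHK.lean`.
[cite: VandenbergHaggstromKahn2005, Thm. 1.1 (pp. 3–5), §1 p. 4] [cite: KozmaNitzan2024, §3.2 (p. 12)]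
-/

noncomputable section

namespace Summit.CriticalPhenomena.PercolationContinuityZ3.Theorems

open MeasureTheory Set Literature.Probability.LatticeModels Literature.Probability.Percolation
open Literature.Probability.Percolation.BHK2006
open DecisionTree (ind ind_of_mem ind_of_not_mem ind_nonneg)
open scoped Classical

namespace KNGoodPocketBHK

variable {V : Type*}

/-! ### The vertex cluster of `o` and the pocket-augmented event, in `G[U]` -/

/-- The vertex set `C^U(o)` of the open cluster of `o`, computed with the open edges inside `U` only.
[cite: KozmaNitzan2024, §3.2 p. 12 (the cluster `C(0)`)] -/
def oV (U : Finset V) (o : V) (ω : Set (Sym2 V)) : Set V := {v | (openGraph (ω ∩ edgesIn U)).Reachable o v}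

/-- The pocket-augmented event `F = {o ↔ s} ∪ {C(o) ∈ 𝒬}` in `G[U]`.
[cite: KozmaNitzan2024, §3.2 p. 12 (the events `C(0) = W`)] -/
def fEv (U : Finset V) (s o : V) (Q : Set (Set V)) : Set (Set (Sym2 V)) := {ω | s ∈ oV U o ω ∨ oV U o ω ∈ Q}

/-- The pocket event `{C^U(o) = W}`. [cite: KozmaNitzan2024, §3.2 p. 12] -/
def pocketEv (U : Finset V) (o : V) (W : Set V) : Set (Set (Sym2 V)) := {ω | oV U o ω = W}

/-- The unordered pairs meeting the vertex set `W`. [folklore] -/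
def meetS (W : Set V) : Set (Sym2 V) := {e | ∃ v ∈ W, v ∈ e}

/-- The sub-family of the members of `Q` disjoint from `T`. [folklore] -/
def qRestr (Q : Set (Set V)) (T : Set V) : Set (Set V) := {W | W ∈ Q ∧ Disjoint W T}

/-- `o ∈ C^U(o)`. [folklore] -/
theorem mem_oV_self (U : Finset V) (o : V) (ω : Set (Sym2 V)) : o ∈ oV U o ω := SimpleGraph.Reachable.refl o

/-- `C^U(o)` is increasing in the configuration. [folklore] -/
theorem oV_mono {U : Finset V} {o : V} {ω ω' : Set (Sym2 V)} (h : ω ⊆ ω') : oV U o ω ⊆ oV U o ω' :=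
  fun _ hv => hv.mono (openGraph_le (Set.inter_subset_inter_left _ h))

/-- `C^{U'}(o) ⊆ C^U(o)` for `U' ⊆ U`. [folklore] -/
theorem oV_mono_U {U U' : Finset V} (h : U' ⊆ U) (o : V) (ω : Set (Sym2 V)) : oV U' o ω ⊆ oV U o ω :=
  fun _ hv => hv.mono (openGraph_le (Set.inter_subset_inter_right _ (edgesIn_mono h)))

/-- `qRestr` is antitone in the excluded set. [folklore] -/
theorem qRestr_mono {Q : Set (Set V)} {T T' : Set V} (h : T ⊆ T') : qRestr Q T' ⊆ qRestr Q T :=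
  fun _ hW => ⟨hW.1, hW.2.mono_right h⟩

/-- `fEv` is monotone in the family. [folklore] -/
theorem fEv_mono {U : Finset V} {s o : V} {Q Q' : Set (Set V)} (h : Q ⊆ Q') : fEv U s o Q ⊆ fEv U s o Q' :=
  fun _ hω => hω.imp id fun hq => h hq

/-! ### Locality of clusters: a path cannot leave a full cluster -/

/-- If every vertex reachable from `o` in the smaller open graph `ω ∩ M` lies in `W`, then every vertex reachable
from `o` in `ω` is reachable in `ω ∩ M`, provided `M` contains all pairs meeting `W`. [folklore] -/
theorem reach_inter_of_subset {U : Finset V} {o : V} {W : Set V} {M : Set (Sym2 V)} (hM : meetS W ⊆ M)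
    {ω : Set (Sym2 V)} (hW : ∀ u, (openGraph ((ω ∩ M) ∩ edgesIn U)).Reachable o u → u ∈ W) {v : V}
    (hv : (openGraph (ω ∩ edgesIn U)).Reachable o v) : (openGraph ((ω ∩ M) ∩ edgesIn U)).Reachable o v := by
  rw [SimpleGraph.reachable_iff_reflTransGen] at hv
  induction hv with
  | refl => exact SimpleGraph.Reachable.refl o
  | tail _ hbc ih =>
    obtain ⟨hω, hUU, hne⟩ := adj_iff.1 hbc
    have hbW := hW _ ih
    refine ih.trans (SimpleGraph.Adj.reachable (adj_iff.2 ⟨⟨hω, hM ⟨_, hbW, Sym2.mem_mk_left _ _⟩⟩, hUU, hne⟩))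

/-- **`{C(o) = W}` is determined by the pairs meeting `W`**: `C^U(o)(ω) = W ↔ C^U(o)(ω ∩ meetS W) = W`. [folklore] -/
theorem oV_eq_iff_inter_meetS (U : Finset V) (o : V) (W : Set V) (ω : Set (Sym2 V)) :
    oV U o ω = W ↔ oV U o (ω ∩ meetS W) = W := by
  constructor
  · intro h
    have hW : ∀ u, (openGraph ((ω ∩ meetS W) ∩ edgesIn U)).Reachable o u → u ∈ W := fun u hu => by
      rw [← h]; exact oV_mono Set.inter_subset_left hu
    ext v
    refine ⟨fun hv => by rw [← h]; exact oV_mono Set.inter_subset_left hv, fun hv => ?_⟩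
    rw [← h] at hv
    exact reach_inter_of_subset subset_rfl hW hv
  · intro h
    have hW : ∀ u, (openGraph ((ω ∩ meetS W) ∩ edgesIn U)).Reachable o u → u ∈ W := fun u hu => by
      rw [← h]; exact hu
    ext v
    refine ⟨fun hv => ?_, fun hv => by rw [← h] at hv; exact oV_mono Set.inter_subset_left hv⟩
    rw [← h]
    exact reach_inter_of_subset subset_rfl hW hv

/-- On `{C(o) = W}` with `s ∉ W`, every open path from `s` avoids the pairs meeting `W`. [folklore] -/
theorem reach_diff_meetS {U : Finset V} {s o : V} {W : Set V} {ω : Set (Sym2 V)} (hs : s ∉ W)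
    (hW : oV U o ω = W) {v : V} (hv : (openGraph (ω ∩ edgesIn U)).Reachable s v) :
    (openGraph ((ω \ meetS W) ∩ edgesIn U)).Reachable s v := by
  -- no vertex reachable from `s` lies in `W`
  have key : ∀ u, (openGraph (ω ∩ edgesIn U)).Reachable s u → u ∉ W := by
    intro u hu huW
    rw [← hW] at huW
    exact hs (hW ▸ (huW.trans hu.symm : (openGraph (ω ∩ edgesIn U)).Reachable o s))
  rw [SimpleGraph.reachable_iff_reflTransGen] at hv
  induction hv with
  | refl => exact SimpleGraph.Reachable.refl s
  | tail hab hbc ih =>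
    obtain ⟨hω, hUU, hne⟩ := adj_iff.1 hbc
    have hab' : (openGraph (ω ∩ edgesIn U)).Reachable s _ := (SimpleGraph.reachable_iff_reflTransGen _ _).2 hab
    have hb := key _ hab'
    have hc := key _ (hab'.trans hbc.reachable)
    refine ih.trans (SimpleGraph.Adj.reachable (adj_iff.2 ⟨⟨hω, ?_⟩, hUU, hne⟩))
    rintro ⟨v, hvW, hv⟩
    rcases Sym2.mem_iff.1 hv with rfl | rfl
    · exact hb hvW
    · exact hc hvW

/-- On `{C(o) = W}` with `s ∉ W`, the cluster of `s` does not depend on the pairs meeting `W`. [folklore] -/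
theorem rC_eq_diff_meetS {U : Finset V} {s o : V} {W : Set V} {ω : Set (Sym2 V)} (hs : s ∉ W)
    (hW : oV U o ω = W) : rC U s ω = rC U s (ω \ meetS W) := by
  refine Set.Subset.antisymm ?_ (rC_mono U s fun _ h => h.1)
  rintro e ⟨⟨heω, heU⟩, hd, hr⟩
  refine ⟨⟨⟨heω, ?_⟩, heU⟩, hd, fun v hv => reach_diff_meetS hs hW (hr v hv)⟩
  rintro ⟨v, hvW, hve⟩
  have hsv : (openGraph (ω ∩ edgesIn U)).Reachable s v := hr v hve
  rw [← hW] at hvW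
  exact hs (hW ▸ (hvW.trans hsv.symm : (openGraph (ω ∩ edgesIn U)).Reachable o s))

/-- On `{C(o) = W}` with `s ∉ W`, the events `{s ↮ Y}` do not depend on the pairs meeting `W`. [folklore] -/
theorem mem_rD_iff_diff_meetS {U : Finset V} {s o : V} {W : Set V} {ω : Set (Sym2 V)} (hs : s ∉ W)
    (hW : oV U o ω = W) (Y : Set V) : ω ∈ rD U s Y ↔ ω \ meetS W ∈ rD U s Y := by
  refine ⟨fun h y hy hr => h y hy (hr.mono (openGraph_le (Set.inter_subset_inter_left _ fun _ h => h.1))),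
    fun h y hy hr => h y hy (reach_diff_meetS hs hW hr)⟩


/-- The indicator of the pocket event as an `if`. [folklore] -/
theorem ind_pocketEv (U : Finset V) (o : V) (W : Set V) (ω : Set (Sym2 V)) :
    ind (pocketEv U o W) ω = if oV U o ω = W then 1 else 0 := rfl

/-- The pocket indicator only depends on the pairs meeting the pocket. [folklore] -/
theorem ind_pocketEv_inter (U : Finset V) (o : V) (W : Set V) (ω : Set (Sym2 V)) :
    ind (pocketEv U o W) (ω ∩ meetS W) = ind (pocketEv U o W) ω := by
  rw [ind_pocketEv, ind_pocketEv]
  by_cases h : oV U o ω = W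
  · rw [if_pos h, if_pos ((oV_eq_iff_inter_meetS U o W ω).1 h)]
  · rw [if_neg h, if_neg fun h' => h ((oV_eq_iff_inter_meetS U o W ω).2 h')]


/-! ### The pocket lemma (base case): given `C(o) = W`, the rest is percolation on `G ∖ W` -/

section Sums

variable [Fintype V] {w : Sym2 V → ℝ}

/-- **The complement of `F` splits into pockets**: `1 − 1_F = Σ_{W ∌ s, W ∉ 𝒬} 1{C(o) = W}`. [folklore] -/
theorem one_sub_ind_fEv (U : Finset V) (s o : V) (Q : Set (Set V)) (ω : Set (Sym2 V)) :
    1 - ind (fEv U s o Q) ω =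
      ∑ W ∈ (Finset.univ : Finset (Set V)).filter (fun W => s ∉ W ∧ W ∉ Q), ind (pocketEv U o W) ω := by
  simp only [ind_pocketEv]
  rw [Finset.sum_ite_eq]
  by_cases h : ω ∈ fEv U s o Q
  · rw [ind_of_mem h, if_neg]
    · ring
    · rw [Finset.mem_filter, not_and, not_and_or, not_not, not_not]
      exact fun _ => h
  · rw [ind_of_not_mem h, if_pos]
    · ring
    · rw [Finset.mem_filter]
      exact ⟨Finset.mem_univ _, not_or.1 h⟩

/-- **Pocket lemma, increasing side**: `E[H(C_s); C(o) = W] ≤ P(C(o) = W) · E[H(C_s)]` for `W ∌ s` and `H ≥ 0`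
increasing (given `C(o) = W` the cluster of `s` lives in `G ∖ W`, where it is smaller).
[cite: VandenbergHaggstromKahn2005, §1 p. 4 (the induced model on `G ∖ Z`)] -/
theorem pocket_le (hw0 : ∀ e, 0 ≤ w e) (hw1 : ∀ e, w e ≤ 1) (hm : ∑ ω, weight w ω = 1) (U : Finset V)
    (s o : V) {W : Set V} (hs : s ∉ W) {H : Set (Sym2 V) → ℝ} (hH : Monotone H) :
    ∑ ω, weight w ω * (H (rC U s ω) * ind (pocketEv U o W) ω) ≤
      (∑ ω, weight w ω * ind (pocketEv U o W) ω) * ∑ ω, weight w ω * H (rC U s ω) := by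
  set A := meetS W with hA
  set Φ : Set (Sym2 V) → Set (Sym2 V) → ℝ := fun ζ η => ind (pocketEv U o W) ζ * H (rC U s η) with hΦ
  have h1 : ∀ ω, H (rC U s ω) * ind (pocketEv U o W) ω = Φ (ω ∩ A) (ω \ A) := by
    intro ω
    simp only [hΦ, hA, ind_pocketEv_inter]
    by_cases hω : oV U o ω = W
    · rw [ind_pocketEv, if_pos hω, ← rC_eq_diff_meetS hs hω]; ring
    · rw [ind_pocketEv, if_neg hω]; ring
  have h2 : ∀ ω ω', Φ (ω ∩ A) (ω' \ A) = ind (pocketEv U o W) ω * H (rC U s (ω' \ A)) := by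
    intro ω ω'
    simp only [hΦ, hA, ind_pocketEv_inter]
  calc ∑ ω, weight w ω * (H (rC U s ω) * ind (pocketEv U o W) ω)
      = (∑ ω, weight w ω) * ∑ ω, weight w ω * Φ (ω ∩ A) (ω \ A) := by rw [hm, one_mul]; simp_rw [h1]
    _ = ∑ ω, weight w ω * ∑ ω', weight w ω' * Φ (ω ∩ A) (ω' \ A) := blockFubini w A Φ
    _ = ∑ ω, weight w ω * ind (pocketEv U o W) ω * ∑ ω', weight w ω' * H (rC U s (ω' \ A)) := by
        simp_rw [h2]
        refine Finset.sum_congr rfl fun ω _ => ?_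
        rw [Finset.mul_sum, Finset.mul_sum]
        exact Finset.sum_congr rfl fun ω' _ => by ring
    _ ≤ ∑ ω, weight w ω * ind (pocketEv U o W) ω * ∑ ω', weight w ω' * H (rC U s ω') := by
        refine Finset.sum_le_sum fun ω _ => mul_le_mul_of_nonneg_left ?_
          (mul_nonneg (weight_nonneg hw0 hw1 ω) (ind_nonneg _ _))
        exact Finset.sum_le_sum fun ω' _ => mul_le_mul_of_nonneg_left
          (hH (rC_mono U s fun _ h => h.1)) (weight_nonneg hw0 hw1 ω')
    _ = (∑ ω, weight w ω * ind (pocketEv U o W) ω) * ∑ ω, weight w ω * H (rC U s ω) := by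
        rw [Finset.sum_mul]

/-- **Pocket lemma, decreasing side**: `P(C(o) = W) · P(s ↮ Y) ≤ P(C(o) = W, s ↮ Y)` for `W ∌ s`.
[cite: VandenbergHaggstromKahn2005, §1 p. 4 (the induced model on `G ∖ Z`)] -/
theorem pocket_ge (hw0 : ∀ e, 0 ≤ w e) (hw1 : ∀ e, w e ≤ 1) (hm : ∑ ω, weight w ω = 1) (U : Finset V)
    (s o : V) {W : Set V} (hs : s ∉ W) (Y : Set V) :
    (∑ ω, weight w ω * ind (pocketEv U o W) ω) * (∑ ω, weight w ω * ind (rD U s Y) ω) ≤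
      ∑ ω, weight w ω * (ind (rD U s Y) ω * ind (pocketEv U o W) ω) := by
  set A := meetS W with hA
  set Φ : Set (Sym2 V) → Set (Sym2 V) → ℝ := fun ζ η => ind (pocketEv U o W) ζ * ind (rD U s Y) η with hΦ
  have h1 : ∀ ω, ind (rD U s Y) ω * ind (pocketEv U o W) ω = Φ (ω ∩ A) (ω \ A) := by
    intro ω
    simp only [hΦ, hA, ind_pocketEv_inter]
    by_cases hω : oV U o ω = W
    · rw [ind_pocketEv, if_pos hω]
      by_cases hY : ω ∈ rD U s Y
      · rw [ind_of_mem hY, ind_of_mem ((mem_rD_iff_diff_meetS hs hω Y).1 hY)]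
      · rw [ind_of_not_mem hY, ind_of_not_mem fun h => hY ((mem_rD_iff_diff_meetS hs hω Y).2 h)]; ring
    · rw [ind_pocketEv, if_neg hω]; ring
  have h2 : ∀ ω ω', Φ (ω ∩ A) (ω' \ A) = ind (pocketEv U o W) ω * ind (rD U s Y) (ω' \ A) := by
    intro ω ω'
    simp only [hΦ, hA, ind_pocketEv_inter]
  calc (∑ ω, weight w ω * ind (pocketEv U o W) ω) * (∑ ω, weight w ω * ind (rD U s Y) ω)
      = ∑ ω, weight w ω * ind (pocketEv U o W) ω * ∑ ω', weight w ω' * ind (rD U s Y) ω' := by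
        rw [Finset.sum_mul]
    _ ≤ ∑ ω, weight w ω * ind (pocketEv U o W) ω * ∑ ω', weight w ω' * ind (rD U s Y) (ω' \ A) := by
        refine Finset.sum_le_sum fun ω _ => mul_le_mul_of_nonneg_left ?_
          (mul_nonneg (weight_nonneg hw0 hw1 ω) (ind_nonneg _ _))
        exact Finset.sum_le_sum fun ω' _ => mul_le_mul_of_nonneg_left
          (ind_rD_antitone U s Y (fun _ h => h.1 : ω' \ A ⊆ ω')) (weight_nonneg hw0 hw1 ω')
    _ = ∑ ω, weight w ω * ∑ ω', weight w ω' * Φ (ω ∩ A) (ω' \ A) := by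
        simp_rw [h2]
        refine Finset.sum_congr rfl fun ω _ => ?_
        rw [Finset.mul_sum, Finset.mul_sum]
        exact Finset.sum_congr rfl fun ω' _ => by ring
    _ = (∑ ω, weight w ω) * ∑ ω, weight w ω * Φ (ω ∩ A) (ω \ A) := (blockFubini w A Φ).symm
    _ = ∑ ω, weight w ω * (ind (rD U s Y) ω * ind (pocketEv U o W) ω) := by rw [hm, one_mul]; simp_rw [h1]

/-- **Pocket-Harris, increasing side**: `E[H(C_s)] · P(F) ≤ E[H(C_s) 1_F]` — the pocket-augmented event is
positively correlated with every increasing `H ≥ 0` of `C_s` (sum of the pocket lemma over the pockets outside `F`).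
[cite: VandenbergHaggstromKahn2005, §1 p. 4] -/
theorem sum_mul_fEv_ge (hw0 : ∀ e, 0 ≤ w e) (hw1 : ∀ e, w e ≤ 1) (hm : ∑ ω, weight w ω = 1) (U : Finset V)
    (s o : V) (Q : Set (Set V)) {H : Set (Sym2 V) → ℝ} (hH : Monotone H) :
    (∑ ω, weight w ω * H (rC U s ω)) * (∑ ω, weight w ω * ind (fEv U s o Q) ω) ≤
      ∑ ω, weight w ω * (H (rC U s ω) * ind (fEv U s o Q) ω) := by
  set 𝒲 := (Finset.univ : Finset (Set V)).filter (fun W => s ∉ W ∧ W ∉ Q) with h𝒲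
  -- `E[H (1 - 1_F)] = Σ_W E[H 1_W] ≤ Σ_W P(W) E[H] = (1 - P(F)) E[H]`
  have e1 : ∑ ω, weight w ω * (H (rC U s ω) * (1 - ind (fEv U s o Q) ω)) =
      ∑ W ∈ 𝒲, ∑ ω, weight w ω * (H (rC U s ω) * ind (pocketEv U o W) ω) := by
    rw [Finset.sum_comm]
    refine Finset.sum_congr rfl fun ω _ => ?_
    rw [one_sub_ind_fEv, Finset.mul_sum, Finset.mul_sum]
  have e2 : ∑ ω, weight w ω * (1 - ind (fEv U s o Q) ω) = ∑ W ∈ 𝒲, ∑ ω, weight w ω * ind (pocketEv U o W) ω := by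
    rw [Finset.sum_comm]
    refine Finset.sum_congr rfl fun ω _ => ?_
    rw [one_sub_ind_fEv, Finset.mul_sum]
  have h3 : ∑ W ∈ 𝒲, ∑ ω, weight w ω * (H (rC U s ω) * ind (pocketEv U o W) ω) ≤
      ∑ W ∈ 𝒲, (∑ ω, weight w ω * ind (pocketEv U o W) ω) * ∑ ω, weight w ω * H (rC U s ω) :=
    Finset.sum_le_sum fun W hW => pocket_le hw0 hw1 hm U s o (Finset.mem_filter.1 hW).2.1 hH
  rw [← Finset.sum_mul, ← e2] at h3
  have e3 : ∑ ω, weight w ω * (H (rC U s ω) * (1 - ind (fEv U s o Q) ω)) =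
      ∑ ω, weight w ω * H (rC U s ω) - ∑ ω, weight w ω * (H (rC U s ω) * ind (fEv U s o Q) ω) := by
    rw [← Finset.sum_sub_distrib]; refine Finset.sum_congr rfl fun ω _ => by ring
  have e4 : ∑ ω, weight w ω * (1 - ind (fEv U s o Q) ω) = 1 - ∑ ω, weight w ω * ind (fEv U s o Q) ω := by
    have : ∀ ω, weight w ω * (1 - ind (fEv U s o Q) ω) = weight w ω - weight w ω * ind (fEv U s o Q) ω :=
      fun ω => by ring
    simp_rw [this, Finset.sum_sub_distrib, hm]
  rw [e1] at e3
  rw [e3, e4] at h3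
  nlinarith [h3]

/-- **Pocket-Harris, decreasing side**: `P(F, s ↮ Y) ≤ P(F) · P(s ↮ Y)`.
[cite: VandenbergHaggstromKahn2005, §1 p. 4] -/
theorem sum_fEv_rD_le (hw0 : ∀ e, 0 ≤ w e) (hw1 : ∀ e, w e ≤ 1) (hm : ∑ ω, weight w ω = 1) (U : Finset V)
    (s o : V) (Q : Set (Set V)) (Y : Set V) :
    ∑ ω, weight w ω * (ind (fEv U s o Q) ω * ind (rD U s Y) ω) ≤
      (∑ ω, weight w ω * ind (fEv U s o Q) ω) * ∑ ω, weight w ω * ind (rD U s Y) ω := by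
  set 𝒲 := (Finset.univ : Finset (Set V)).filter (fun W => s ∉ W ∧ W ∉ Q) with h𝒲
  have e1 : ∑ ω, weight w ω * (ind (rD U s Y) ω * (1 - ind (fEv U s o Q) ω)) =
      ∑ W ∈ 𝒲, ∑ ω, weight w ω * (ind (rD U s Y) ω * ind (pocketEv U o W) ω) := by
    rw [Finset.sum_comm]
    refine Finset.sum_congr rfl fun ω _ => ?_
    rw [one_sub_ind_fEv, Finset.mul_sum, Finset.mul_sum]
  have e2 : ∑ ω, weight w ω * (1 - ind (fEv U s o Q) ω) = ∑ W ∈ 𝒲, ∑ ω, weight w ω * ind (pocketEv U o W) ω := by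
    rw [Finset.sum_comm]
    refine Finset.sum_congr rfl fun ω _ => ?_
    rw [one_sub_ind_fEv, Finset.mul_sum]
  have h3 : ∑ W ∈ 𝒲, (∑ ω, weight w ω * ind (pocketEv U o W) ω) * (∑ ω, weight w ω * ind (rD U s Y) ω) ≤
      ∑ W ∈ 𝒲, ∑ ω, weight w ω * (ind (rD U s Y) ω * ind (pocketEv U o W) ω) :=
    Finset.sum_le_sum fun W hW => pocket_ge hw0 hw1 hm U s o (Finset.mem_filter.1 hW).2.1 Y
  rw [← Finset.sum_mul, ← e2, ← e1] at h3
  have e3 : ∑ ω, weight w ω * (ind (rD U s Y) ω * (1 - ind (fEv U s o Q) ω)) =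
      ∑ ω, weight w ω * ind (rD U s Y) ω - ∑ ω, weight w ω * (ind (fEv U s o Q) ω * ind (rD U s Y) ω) := by
    rw [← Finset.sum_sub_distrib]; refine Finset.sum_congr rfl fun ω _ => by ring
  have e4 : ∑ ω, weight w ω * (1 - ind (fEv U s o Q) ω) = 1 - ∑ ω, weight w ω * ind (fEv U s o Q) ω := by
    have : ∀ ω, weight w ω * (1 - ind (fEv U s o Q) ω) = weight w ω - weight w ω * ind (fEv U s o Q) ω :=
      fun ω => by ring
    simp_rw [this, Finset.sum_sub_distrib, hm]
  rw [e3, e4] at h3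
  nlinarith [h3]

/-- **Base case of the induction** (`X ∩ Y = ∅`, but valid for all `X, Y`):
`E[H(C_s) 1{s↮X}] · P(F, s↮Y) ≤ E[H(C_s) 1_F] · P(s↮X, s↮Y)` — pocket-Harris twice and Harris twice.
[cite: VandenbergHaggstromKahn2005, §1 p. 4, display (4)] -/
theorem base (hw0 : ∀ e, 0 ≤ w e) (hw1 : ∀ e, w e ≤ 1) (hm : ∑ ω, weight w ω = 1) (U : Finset V)
    (s o : V) (X Y : Set V) (Q : Set (Set V)) {H : Set (Sym2 V) → ℝ} (hH : Monotone H) (hH0 : ∀ a, 0 ≤ H a) :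
    (∑ ω, weight w ω * (H (rC U s ω) * ind (rD U s X) ω)) *
        (∑ ω, weight w ω * (ind (fEv U s o Q) ω * ind (rD U s Y) ω)) ≤
      (∑ ω, weight w ω * (H (rC U s ω) * ind (fEv U s o Q) ω)) *
        ∑ ω, weight w ω * (ind (rD U s X) ω * ind (rD U s Y) ω) := by
  have hHm : Monotone fun ω => H (rC U s ω) := fun a b hab => hH (rC_mono U s hab)
  have ha : ∑ ω, weight w ω * (H (rC U s ω) * ind (rD U s X) ω) ≤
      (∑ ω, weight w ω * H (rC U s ω)) * ∑ ω, weight w ω * ind (rD U s X) ω :=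
    harris_mono_anti hw0 hw1 hm (fun _ => hH0 _) hHm (ind_rD_antitone U s X) (fun _ => ind_le_one _ _)
  have hd : (∑ ω, weight w ω * ind (rD U s X) ω) * (∑ ω, weight w ω * ind (rD U s Y) ω) ≤
      ∑ ω, weight w ω * (ind (rD U s X) ω * ind (rD U s Y) ω) :=
    harris_anti_anti hw0 hw1 hm (ind_rD_antitone U s X) (ind_rD_antitone U s Y) (fun _ => ind_le_one _ _)
      (fun _ => ind_le_one _ _)
  have hc := sum_mul_fEv_ge hw0 hw1 hm U s o Q hH
  have hb := sum_fEv_rD_le hw0 hw1 hm U s o Q Y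
  have nH : 0 ≤ ∑ ω, weight w ω * H (rC U s ω) :=
    Finset.sum_nonneg fun ω _ => mul_nonneg (weight_nonneg hw0 hw1 ω) (hH0 _)
  have nX : 0 ≤ ∑ ω, weight w ω * ind (rD U s X) ω :=
    Finset.sum_nonneg fun ω _ => mul_nonneg (weight_nonneg hw0 hw1 ω) (ind_nonneg _ _)
  have nY : 0 ≤ ∑ ω, weight w ω * ind (rD U s Y) ω :=
    Finset.sum_nonneg fun ω _ => mul_nonneg (weight_nonneg hw0 hw1 ω) (ind_nonneg _ _)
  have nF : 0 ≤ ∑ ω, weight w ω * ind (fEv U s o Q) ω :=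
    Finset.sum_nonneg fun ω _ => mul_nonneg (weight_nonneg hw0 hw1 ω) (ind_nonneg _ _)
  have nb : 0 ≤ ∑ ω, weight w ω * (ind (fEv U s o Q) ω * ind (rD U s Y) ω) :=
    Finset.sum_nonneg fun ω _ => mul_nonneg (weight_nonneg hw0 hw1 ω) (mul_nonneg (ind_nonneg _ _) (ind_nonneg _ _))
  calc (∑ ω, weight w ω * (H (rC U s ω) * ind (rD U s X) ω)) *
          (∑ ω, weight w ω * (ind (fEv U s o Q) ω * ind (rD U s Y) ω))
      ≤ ((∑ ω, weight w ω * H (rC U s ω)) * ∑ ω, weight w ω * ind (rD U s X) ω) *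
          ((∑ ω, weight w ω * ind (fEv U s o Q) ω) * ∑ ω, weight w ω * ind (rD U s Y) ω) :=
        mul_le_mul ha hb nb (mul_nonneg nH nX)
    _ = ((∑ ω, weight w ω * H (rC U s ω)) * ∑ ω, weight w ω * ind (fEv U s o Q) ω) *
          ((∑ ω, weight w ω * ind (rD U s X) ω) * ∑ ω, weight w ω * ind (rD U s Y) ω) := by ring
    _ ≤ (∑ ω, weight w ω * (H (rC U s ω) * ind (fEv U s o Q) ω)) *
          ∑ ω, weight w ω * (ind (rD U s X) ω * ind (rD U s Y) ω) :=
        mul_le_mul hc hd (mul_nonneg nX nY) (Finset.sum_nonneg fun ω _ =>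
          mul_nonneg (weight_nonneg hw0 hw1 ω) (mul_nonneg (hH0 _) (ind_nonneg _ _)))

end Sums

end KNGoodPocketBHK

end Summit.CriticalPhenomena.PercolationContinuityZ3.Theorems
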